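import Summits.Parity.GeneralizedHardyLittlewood.Theorems.AbsoluteUpgrade.Negative.CellParityLawSavingLoadBearing
import Summits.Parity.GeneralizedHardyLittlewood.Theorems.LeeYangFibresAbsoluteUpgradeHighMass
import Literature.NumberTheory.Sieve.LinearEquationsInPrimesOneForm
import HarnessLib

/-!
# Crux `CellParityLawSaving` (stmt-Parity-18104): the corner squeeze (negative-side engine) and two typing facts

Negative-side support from the crux disprover (cdisprove seat, cycle 1) for the LOAD-BEARING crux
`LeeYangFibres.CellParityLawSaving` of route `LeeYangFibres` (`Iff.rfl`-equal to the dip line's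
`DipMarginRateExchange.CellParityLawSaving`; vocabulary `jointCell`, `cell`, `slowDegree`, `walshForm`).
Sorry-free, unconditional; no proposition is defined under `Summits/`.

* `sum_walshForm_pairs`: on the `2^t` corner cells `j ∈ {1,2}^t` the Walsh weights
  `W_θ(j) = Σ_S θ_S ∏_{i∈S} (-1)^{j_i+1}` sum to `2^t θ_∅` — the amplitude `θ_∅ = 1` is the law's one rigid
  datum (total corner mass); the `2^t − 1` free amplitudes cannot move it.
* `corner_squeeze`: hence the conclusion block of the crux forces
  `min_corner (β_∞ 𝔖 ∏_i A_{j_i}/N) ≤ max_corner C_j + allowance`, WHATEVER the free amplitudes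
  (`corners_of_conclusion` extracts the corner deviations from the verbatim `∃ θ …` block).
* scale facts used by every load-bearing witness (`Negative/LoadBearingHypotheses.lean`): `jointCell_le`
  (`C_j ≤ 2N+1`), `allowance_le` (`≤ N`), `eventually_corner_cells` (`A_{1,2}(N) ≥ cN/log N` along `U(N)`).
* `law_zero_forms` — the hypothesis `1 ≤ t` of the crux is NOT load-bearing: the `t = 0` instance of the
  conclusion holds outright (`δ = 1`, `N ≥ 3`; lattice content of an interval against its length, tree
  `DimOne.exists_filter_eq_Icc`).  Information for the planner; nothing to repair.
* `cell_top_eq_zero` — the top model cell is EMPTY, `A_U(N) = 0` (a product of `U` primes `> N^{1/U}` exceeds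
  `N`): the proved half of "a RELATIVE allowance would be false at `j_i = U(N)`" (shifted systems have rough
  values with `Ω = U` in `(N, LN]`); the crux's purely absolute allowance is deliberate and sound.

This file does NOT refute the crux (companion workfile `Cruxes/CellParityLawSaving/Disproof.lean`, §3: why it
resists). [folklore]
-/

noncomputable section

namespace Summit.Parity.GeneralizedHardyLittlewood.Theorems.CellParityLawSaving.Negative

open scoped BigOperators Classical
open Filter MeasureTheory Finset Literature.NumberTheory.Sieve
open Summit.Parity.GeneralizedHardyLittlewood.Cruxes.FibreHyperbolicity.ModelTransfer (jointCell)
open Summit.Parity.GeneralizedHardyLittlewood.Cruxes.AbsoluteUpgrade.DipMarginRateExchange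
  (slowDegree four_le_slowDegree)
open Summit.Parity.GeneralizedHardyLittlewood.Theorems.ModelHyperbolicity.Negative (cell)
open Summit.Parity.GeneralizedHardyLittlewood.Cruxes.AbsoluteUpgrade.NlcCellsAbsoluteClip (roughCell walshForm)
open Summit.Parity.GeneralizedHardyLittlewood.Theorems.AbsoluteUpgrade
  (roughCell_four_le stub_roughAnatomy exists_corner_lower isNondegenerateSystem_shiftPair
    singularProduct_shiftPair_ge exists_sum_primesLE_inv_ge archFactor_shiftPair_ge)
open Summit.Parity.GeneralizedHardyLittlewood.Theorems.AbsoluteUpgrade.Negative.CellSaving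
  (cell_eq_roughCell walsh_fin_one)
open Summit.Parity.GeneralizedHardyLittlewood.Theorems.AbsoluteUpgrade.Negative.FibreAlong
  (jointCell_eq_zero_of_forall_not_mem isNondegenerateSystem_id affLinSize_id archFactor_id_boxMinusLattice
    realPoint_not_mem_boxMinusLattice)
open Summit.Parity.GeneralizedHardyLittlewood.Theorems.PrimeCellsRelative.Negative.BoxContainment
  (singularProduct_id)

/-! ## The engine: Walsh mean on the corner cells, and the squeeze -/

/-- On the `2^t` corner cells `j ∈ {1,2}^t` the Walsh weights sum to `2^t θ_∅`: every non-empty `S` sees both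
signs in each of its coordinates. [folklore] -/
theorem sum_walshForm_pairs {t : ℕ} (θ : Finset (Fin t) → ℝ) :
    ∑ j ∈ Fintype.piFinset (fun _ : Fin t => ({1, 2} : Finset ℕ)), walshForm θ j = 2 ^ t * θ ∅ := by
  classical
  unfold walshForm
  rw [Finset.sum_comm]
  have hinner : ∀ S : Finset (Fin t),
      ∑ j ∈ Fintype.piFinset (fun _ : Fin t => ({1, 2} : Finset ℕ)), θ S * ∏ i ∈ S, (-1 : ℝ) ^ (j i + 1) =
        θ S * ∏ i : Fin t, (if i ∈ S then (0 : ℝ) else 2) := by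
    intro S
    rw [← Finset.mul_sum]
    congr 1
    have hprod : ∀ j : Fin t → ℕ, ∏ i ∈ S, (-1 : ℝ) ^ (j i + 1) =
        ∏ i : Fin t, (if i ∈ S then (-1 : ℝ) ^ (j i + 1) else 1) := by
      intro j
      rw [Finset.prod_ite_mem, Finset.univ_inter]
    simp_rw [hprod]
    calc ∑ j ∈ Fintype.piFinset (fun _ : Fin t => ({1, 2} : Finset ℕ)),
          ∏ i : Fin t, (if i ∈ S then (-1 : ℝ) ^ (j i + 1) else 1)
        = ∏ i : Fin t, ∑ m ∈ ({1, 2} : Finset ℕ), (if i ∈ S then (-1 : ℝ) ^ (m + 1) else 1) :=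
          (Finset.prod_univ_sum (fun _ : Fin t => ({1, 2} : Finset ℕ))
            (fun i m => if i ∈ S then (-1 : ℝ) ^ (m + 1) else 1)).symm
      _ = ∏ i : Fin t, (if i ∈ S then (0 : ℝ) else 2) := by
          refine Finset.prod_congr rfl fun i _ => ?_
          split_ifs with hi
          · rw [Finset.sum_pair (by norm_num)]
            norm_num
          · rw [Finset.sum_const, Finset.card_pair (by norm_num)]
            norm_num
  simp_rw [hinner]
  rw [Finset.sum_eq_single_of_mem ∅ (Finset.mem_univ _)]
  · simp [mul_comm]
  · intro S _ hS
    obtain ⟨i, hi⟩ := Finset.nonempty_iff_ne_empty.mpr hS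
    rw [Finset.prod_eq_zero (Finset.mem_univ i) (by rw [if_pos hi]), mul_zero]

/-- **Corner squeeze.** If the conclusion holds with `θ_∅ = 1`, every corner cell is `≤ B`, and every corner
model is `≥ P₀ ≥ 0`, then `P₀ ≤ B + E`: the Walsh weights have mean one on the corners, and a weight acts on its
model only through `W_θ(j) · model_j ≤ C_j + E`. [folklore] -/
theorem corner_squeeze {t : ℕ} {θ : Finset (Fin t) → ℝ} (hθ : θ ∅ = 1)
    {C P : (Fin t → ℕ) → ℝ} {B E P₀ : ℝ} (hP₀ : 0 ≤ P₀) (hE : 0 ≤ E) (hB : 0 ≤ B)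
    (hdev : ∀ j ∈ Fintype.piFinset (fun _ : Fin t => ({1, 2} : Finset ℕ)), |C j - walshForm θ j * P j| ≤ E)
    (hC : ∀ j ∈ Fintype.piFinset (fun _ : Fin t => ({1, 2} : Finset ℕ)), C j ≤ B)
    (hP : ∀ j ∈ Fintype.piFinset (fun _ : Fin t => ({1, 2} : Finset ℕ)), P₀ ≤ P j) :
    P₀ ≤ B + E := by
  set J := Fintype.piFinset (fun _ : Fin t => ({1, 2} : Finset ℕ)) with hJ
  have hpt : ∀ j ∈ J, walshForm θ j * P₀ ≤ B + E := by
    intro j hj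
    have h1 : walshForm θ j * P j ≤ C j + E := by
      have h2 : walshForm θ j * P j - C j ≤ E := (abs_sub_le_iff.1 (hdev j hj)).2
      linarith
    rcases le_or_gt 0 (walshForm θ j) with hw | hw
    · calc walshForm θ j * P₀ ≤ walshForm θ j * P j := mul_le_mul_of_nonneg_left (hP j hj) hw
        _ ≤ C j + E := h1
        _ ≤ B + E := by linarith [hC j hj]
    · have : walshForm θ j * P₀ ≤ 0 := mul_nonpos_of_nonpos_of_nonneg hw.le hP₀
      linarith
  have hsum : ∑ j ∈ J, walshForm θ j * P₀ ≤ ∑ _j ∈ J, (B + E) := Finset.sum_le_sum hpt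
  rw [← Finset.sum_mul, hJ, sum_walshForm_pairs, hθ, Finset.sum_const, Fintype.card_piFinset] at hsum
  simp only [Finset.card_pair (show (1 : ℕ) ≠ 2 by norm_num), Finset.prod_const, Finset.card_univ,
    Fintype.card_fin, mul_one, nsmul_eq_mul, Nat.cast_pow, Nat.cast_ofNat] at hsum
  have h2 : (0 : ℝ) < 2 ^ t := by positivity
  nlinarith

/-- Corner indices are admissible cell indices along the schedule (`1 ≤ j_i ≤ 2 ≤ 4 ≤ U(N)`). [folklore] -/
theorem corner_admissible {t : ℕ} (N : ℕ) {j : Fin t → ℕ}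
    (hj : j ∈ Fintype.piFinset (fun _ : Fin t => ({1, 2} : Finset ℕ))) (i : Fin t) :
    1 ≤ j i ∧ j i ≤ slowDegree N := by
  have h := Fintype.mem_piFinset.mp hj i
  simp only [Finset.mem_insert, Finset.mem_singleton] at h
  have h4 := four_le_slowDegree N
  rcases h with h | h <;> rw [h] <;> omega

/-- From the conclusion block to the engine's deviation hypothesis on the corners. [folklore] -/
theorem corners_of_conclusion {t : ℕ} {δ : ℝ} {N : ℕ} {Ψ : Fin t → AffLinForm 1} {K : Set (Fin 1 → ℝ)}
    (h : (∃ θ : Finset (Fin t) → ℝ, θ ∅ = 1 ∧ (∀ S, |θ S| ≤ 2) ∧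
      ∀ j : Fin t → ℕ, (∀ i, 1 ≤ j i ∧ j i ≤ slowDegree N) →
        |(jointCell t N (slowDegree N) Ψ K j : ℝ) -
            (∑ S : Finset (Fin t), θ S * ∏ i ∈ S, (-1 : ℝ) ^ (j i + 1)) *
              (archFactor Ψ K * singularProduct Ψ *
                ∏ i, (cell (slowDegree N) N (j i) : ℝ) / N)| ≤
          (N : ℝ) / (Real.log N ^ t * Real.log N ^ δ))) :
    ∃ θ : Finset (Fin t) → ℝ, θ ∅ = 1 ∧
      ∀ j ∈ Fintype.piFinset (fun _ : Fin t => ({1, 2} : Finset ℕ)),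
        |(jointCell t N (slowDegree N) Ψ K j : ℝ) - walshForm θ j * (archFactor Ψ K * singularProduct Ψ * ∏ i, (cell (slowDegree N) N (j i) : ℝ) / N)| ≤
          (N : ℝ) / (Real.log N ^ t * Real.log N ^ δ) := by
  obtain ⟨θ, hθ, -, hj⟩ := h
  exact ⟨θ, hθ, fun j hjm => hj j (corner_admissible N hjm)⟩

/-! ## Load-bearing hypotheses -/

/-! ### Shared scale facts -/

/-- The lattice box `[-N, N]¹` has `2N + 1` points. [folklore] -/
theorem card_latticeBox_one (N : ℕ) : (latticeBox 1 N).card = 2 * N + 1 := by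
  unfold latticeBox
  rw [Fintype.card_piFinset, Finset.prod_const, Finset.card_univ, Fintype.card_fin, pow_one, Int.card_Icc]
  omega

/-- Every joint cell is at most the lattice content of the box, `2N + 1`. [folklore] -/
theorem jointCell_le {t N u : ℕ} (Ψ : Fin t → AffLinForm 1) (K : Set (Fin 1 → ℝ)) (j : Fin t → ℕ) :
    (jointCell t N u Ψ K j : ℝ) ≤ 2 * N + 1 := by
  have h : jointCell t N u Ψ K j ≤ 2 * N + 1 := by
    unfold jointCell
    exact (Finset.card_filter_le _ _).trans (card_latticeBox_one N).le
  exact_mod_cast h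

/-- The allowance is at most `N` once `log N ≥ 1` (`t` arbitrary, `δ ≥ 0`). [folklore] -/
theorem allowance_le {N t : ℕ} {δ : ℝ} (hN : Real.exp 1 ≤ N) (hδ : 0 ≤ δ) :
    (N : ℝ) / (Real.log N ^ t * Real.log N ^ δ) ≤ N := by
  have hlog : 1 ≤ Real.log N := by
    rw [Real.le_log_iff_exp_le (by linarith [Real.exp_pos 1])]
    exact hN
  have h1 : 1 ≤ Real.log N ^ t * Real.log N ^ δ :=
    one_le_mul_of_one_le_of_one_le (one_le_pow₀ hlog) (Real.one_le_rpow hlog hδ)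
  exact div_le_self (Nat.cast_nonneg N) h1

/-- Corner model cells along the schedule are `≥ c N/log N` eventually (`m = 1, 2`; rough anatomy at `u = 4`
transported to `U(N) ≥ 4`). [folklore] -/
theorem eventually_corner_cells :
    ∃ c : ℝ, 0 < c ∧ ∀ᶠ N : ℕ in atTop, ∀ m ∈ ({1, 2} : Finset ℕ),
      c * (N : ℝ) / Real.log N ≤ (cell (slowDegree N) N m : ℝ) := by
  obtain ⟨c, hc, hev⟩ := exists_corner_lower
  refine ⟨c, hc, ?_⟩
  filter_upwards [hev, eventually_ge_atTop 1] with N hN hN1 m hm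
  have hm' : m ∈ ({1, 2, 3} : Finset ℕ) := by
    simp only [Finset.mem_insert, Finset.mem_singleton] at hm ⊢
    omega
  refine (hN m hm').trans ?_
  rw [cell_eq_roughCell]
  exact_mod_cast roughCell_four_le hN1 (four_le_slowDegree N) m

/-! ### `1 ≤ t` is NOT load-bearing: the law holds for the empty system -/

/-- For the EMPTY system (`t = 0`) the conclusion block holds at every `N ≥ 3` with `δ = 1`: the unique cell is
the lattice content `#(K ∩ ℤ)` of the interval `K`, the model is `β_∞ · 1 · 1 = vol K`, and an interval's
lattice content and length differ by at most `1 ≤ N/log N`.  So the hypothesis `1 ≤ t` of the crux carries no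
content (information for the planner; nothing to repair). [folklore] -/
theorem law_zero_forms {N : ℕ} (hN : 3 ≤ N) (Ψ : Fin 0 → AffLinForm 1) {K : Set (Fin 1 → ℝ)}
    (hK : Convex ℝ K) (hKN : K ⊆ realBox 1 N) :
    ∃ θ : Finset (Fin 0) → ℝ, θ ∅ = 1 ∧ (∀ S, |θ S| ≤ 2) ∧
      ∀ j : Fin 0 → ℕ, (∀ i, 1 ≤ j i ∧ j i ≤ slowDegree N) →
        |(jointCell 0 N (slowDegree N) Ψ K j : ℝ) -
            (∑ S : Finset (Fin 0), θ S * ∏ i ∈ S, (-1 : ℝ) ^ (j i + 1)) *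
              (archFactor Ψ K * singularProduct Ψ *
                ∏ i, (cell (slowDegree N) N (j i) : ℝ) / N)| ≤
          (N : ℝ) / (Real.log N ^ (0 : ℕ) * Real.log N ^ (1 : ℝ)) := by
  refine ⟨fun _ => 1, rfl, fun S => by norm_num, fun j _ => ?_⟩
  -- the singular product of the empty system is `1`
  have hloc : ∀ p : ℕ, p.Prime → localFactor Ψ p = 1 := by
    intro p hp
    have hp0 : (p : ℝ) ≠ 0 := by exact_mod_cast hp.ne_zero
    unfold localFactor
    simp only [Finset.univ_eq_empty, Finset.prod_empty, Finset.sum_const, Fintype.card_piFinset,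
      Finset.card_range, Finset.prod_const, Finset.card_univ, Fintype.card_fin, pow_one, nsmul_eq_mul,
      mul_one]
    exact inv_mul_cancel₀ hp0
  have hS : singularProduct Ψ = 1 := by
    have hev : ∀ x, singularProductPartial Ψ x = 1 := fun x =>
      Finset.prod_eq_one fun p hp => hloc p (Nat.mem_primesLE.mp hp).2
    have hlim : Tendsto (singularProductPartial Ψ) atTop (nhds 1) :=
      tendsto_const_nhds.congr' (Eventually.of_forall fun x => (hev x).symm)
    rw [singularProduct, hlim.limUnder_eq]
  -- the archimedean factor is the length of the slice
  set S : Set ℝ := {r : ℝ | (fun _ : Fin 1 => r) ∈ K} with hSdef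
  have hA : archFactor Ψ K = (volume S).toReal := by
    rw [DimOne.archFactor_eq]
    congr 2
    ext r
    simp [hSdef]
  have hSord : S.OrdConnected := (DimOne.convex_slice hK).ordConnected
  have hSN : S ⊆ Set.Icc (-(N : ℝ)) N := by
    intro r hr
    have := hKN hr
    exact ⟨this.1 0, this.2 0⟩
  obtain ⟨m₁, m₂, hI, hvol⟩ := DimOne.exists_filter_eq_Icc (N := N) hSord hSN
  -- the cell is the lattice content of the slice
  have hcellK : (jointCell 0 N (slowDegree N) Ψ K j : ℝ) = ((Finset.Icc m₁ m₂).card : ℝ) := by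
    unfold jointCell
    rw [DimOne.card_filter_latticeBox, ← hI]
    congr 2
    ext m
    simp only [Finset.mem_filter, IsEmpty.forall_iff, and_true, hSdef, Set.mem_setOf_eq]
    rfl
  rw [hcellK, hS, hA]
  simp only [Finset.univ_eq_empty, Finset.prod_empty, mul_one, one_mul, pow_zero, Real.rpow_one]
  rw [Fintype.sum_eq_single (∅ : Finset (Fin 0)) (fun S hS => absurd (Finset.eq_empty_of_isEmpty S) hS),
    Finset.prod_empty, one_mul]
  refine hvol.trans ?_
  -- `1 ≤ N / log N`
  have hNr : (3 : ℝ) ≤ N := by exact_mod_cast hN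
  have hlogpos : 0 < Real.log N := Real.log_pos (by linarith)
  rw [le_div_iff₀ hlogpos, one_mul]
  have := Real.log_le_sub_one_of_pos (show (0 : ℝ) < N by linarith)
  linarith

/-! ## The top model cell -/

/-- **The top model cell is empty**: `A_U(N) = 0` at roughness `N^{1/U}` (a product of `U` primes each
`> N^{1/U}` exceeds `N`).  Proved half of the near-miss "the RELATIVE-error strengthening
`|C_j − W M_j| ≤ (log N)^{-δ} M_j` is false": at `j = (U, 1, …, 1)` it would force `C_j = 0`, but shifted systems
(`ψ₁(n) = n + b`, `b ≍ N`) have rough values with `Ω = U` in `(N, LN]` — for `U(N) = 4` (all `N < e^{e^{100}}`)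
simply `p⁴`, `N^{1/4} < p ≤ 2N^{1/4}` (Bertrand), `L = 17`; along `U(N) → ∞` one needs primes in
`(x, x(1 + 1/U)]`, i.e. PNT-strength Bertrand, which is why the refutation of the strengthening is not typed here.
[folklore] -/
theorem cell_top_eq_zero {u : ℕ} (N : ℕ) (hu : 1 ≤ u) : cell u N u = 0 := by
  unfold cell
  rw [Finset.card_eq_zero, Finset.filter_eq_empty_iff]
  rintro m hm ⟨hth, hΩ⟩
  rw [Finset.mem_Icc] at hm
  -- `m ≥ (minFac m)^Ω(m) = (minFac m)^u > (N^{1/u})^u = N`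
  have hm0 : m ≠ 0 := by omega
  have hpow : (Nat.minFac m) ^ u ≤ m := by
    rw [← hΩ, ArithmeticFunction.cardFactors_apply]
    conv_rhs => rw [← Nat.prod_primeFactorsList hm0]
    exact List.pow_card_le_prod _ _ fun p hp =>
      Nat.minFac_le_of_dvd (Nat.prime_of_mem_primeFactorsList hp).two_le (Nat.dvd_of_mem_primeFactorsList hp)
  have hNr : (0 : ℝ) ≤ N := Nat.cast_nonneg N
  have hth' : ((N : ℝ) ^ ((1 : ℝ) / u)) ^ u < ((Nat.minFac m : ℕ) : ℝ) ^ u :=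
    pow_lt_pow_left₀ hth (Real.rpow_nonneg hNr _) (by omega)
  rw [← Real.rpow_natCast, ← Real.rpow_mul hNr, one_div_mul_cancel (by exact_mod_cast (show u ≠ 0 by omega)),
    Real.rpow_one] at hth'
  have : (m : ℝ) ≤ N := by exact_mod_cast hm.2
  have : ((Nat.minFac m : ℕ) : ℝ) ^ u ≤ m := by exact_mod_cast hpow
  linarith

end Summit.Parity.GeneralizedHardyLittlewood.Theorems.CellParityLawSaving.Negative

end
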